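import Summits.KontsevichZagierPeriods.KontsevichZagierPeriods.Theorems.SoloInformedRealParamBarrierBdd
import HarnessLib

/-!
# THEOREM T for bounded `KZ_ℝ` chains (kernel form, conditional on generator definability)

**Conservativity of real parameters.** If every bounded generator of `KZ_ℝ` satisfies the
definability invariant (`SoloInformedDefinableRel`), then for bounded integral representations
`r, r'` over `ℚ`: if `r ⊗ ℝ` and `r' ⊗ ℝ` are connected by a BOUNDED chain of the four
Kontsevich–Zagier moves with REAL semialgebraic data, then `r` and `r'` are already connected by a
bounded chain with RATIONAL data (`soloInformed_realParameterTransfer_bdd`); in particular they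
are `KZ`-equivalent over `ℚ` (`soloInformed_equivalent_of_bddEquivalent_real`). Real parameters
buy nothing for bounded chains between `ℚ`-defined periods.

Proof: the chain is the value at `p₀` of a parametrised combination with `ℚ`-semialgebraic good
set `V`; cut `V` by the coincidence clauses at `p₀` (which terms are copies of `r`, of `r'`, of
each other); the cut set is `ℚ`-semialgebraic and nonempty, so it has a point `p₁` with algebraic
coordinates (`soloInformed_realParameter_transfer_core`), whose fibres are `ℚ`-semialgebraic;
definability lifts the combination at `p₁` to a bounded `ℚ`-relation, and the class-function
principle in `FormalRep ℚ ⧸ RelationsBdd ℚ` turns it into `[r] − [r']`.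

References: [cite: KontsevichZagier2001, §1.2]; [cite: BochnakCosteRoy1998, Prop. 2.2.4, 5.2.3].
-/

noncomputable section

open Set MeasureTheory MvPolynomial Literature.ModelTheory.ExponentialFields
  Literature.NumberTheory.Transcendental

namespace Summit.KontsevichZagierPeriods.KontsevichZagierPeriods.Theorems

/-- **THEOREM T (bounded chains).** Conditional on definability of the bounded generators of
`KZ_ℝ`: bounded `KZ_ℝ`-equivalence of the base changes of two bounded `ℚ`-representations
implies bounded `KZ_ℚ`-equivalence. [cite: KontsevichZagier2001, §1.2, Conjecture 1] -/
theorem soloInformed_realParameterTransfer_bdd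
    (hgen : ∀ c ∈ soloInformedBddGenerators ℝ, SoloInformedDefinableRel c)
    {n n' : ℕ} (r : KZOver.IntegralRep ℚ n) (r' : KZOver.IntegralRep ℚ n')
    (hr : SoloInformedBddRep r) (hr' : SoloInformedBddRep r')
    (hc : KZOver.of (r.baseChange ℝ) - KZOver.of (r'.baseChange ℝ) ∈ soloInformedRelationsBdd ℝ) :
    KZOver.of r - KZOver.of r' ∈ soloInformedRelationsBdd ℚ := by
  classical
  -- degenerate case: literally the same representation
  by_cases hAB : (⟨n, r.baseChange ℝ⟩ : Σ m, KZOver.IntegralRep ℝ m) = ⟨n', r'.baseChange ℝ⟩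
  · obtain ⟨h, hcast⟩ := (SoloInformedPTerm.sigma_mk_eq_iff _ _).1 hAB
    have hrr : SoloInformedPTerm.castRep h r = r' :=
      (SoloInformedPTerm.castRep_eq_iff h r r').2 hcast
    rw [← hrr, SoloInformedPTerm.of_castRep, sub_self]
    exact zero_mem _
  obtain ⟨K, hK, P, p₀, V, hV, hp₀, hcombo, hgood, hrat⟩ :=
    soloInformed_definableRel_of_mem_relationsBdd hgen hc
  haveI : Fintype K := hK
  let cA : SoloInformedPTerm K n := SoloInformedPTerm.const K r
  let cB : SoloInformedPTerm K n' := SoloInformedPTerm.const K r'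
  have hAadm : ∀ p, cA.SoloInformedAdm p := fun p => SoloInformedPTerm.adm_const r p hr
  have hBadm : ∀ p, cB.SoloInformedAdm p := fun p => SoloInformedPTerm.adm_const r' p hr'
  let Valid : (K → ℝ) → Prop := fun p => p ∈ V ∧
    (∀ t t' (h : P.dim t = P.dim t'), P.key p₀ t = P.key p₀ t' →
      ((P.term t).castDim h).SoloInformedCoin (P.term t') p) ∧
    (∀ t (h : P.dim t = n), P.key p₀ t = ⟨n, r.baseChange ℝ⟩ →
      ((P.term t).castDim h).SoloInformedCoin cA p) ∧
    (∀ t (h : P.dim t = n'), P.key p₀ t = ⟨n', r'.baseChange ℝ⟩ →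
      ((P.term t).castDim h).SoloInformedCoin cB p)
  -- (1) the clause set is `ℚ`-semialgebraic
  have hValid : IsSemialgebraic ℚ {p | Valid p} := by
    refine soloInformed_isSemialgebraic_setOf_and hV
      (soloInformed_isSemialgebraic_setOf_and ?_ (soloInformed_isSemialgebraic_setOf_and ?_ ?_))
    · exact soloInformed_isSemialgebraic_setOf_forall fun t =>
        soloInformed_isSemialgebraic_setOf_forall fun t' =>
        soloInformed_isSemialgebraic_setOf_forall_prop fun h =>
        soloInformed_isSemialgebraic_setOf_imp (soloInformed_isSemialgebraic_setOf_const _)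
          (SoloInformedPTerm.isSemialgebraic_setOf_coin _ _)
    · exact soloInformed_isSemialgebraic_setOf_forall fun t =>
        soloInformed_isSemialgebraic_setOf_forall_prop fun h =>
        soloInformed_isSemialgebraic_setOf_imp (soloInformed_isSemialgebraic_setOf_const _)
          (SoloInformedPTerm.isSemialgebraic_setOf_coin _ _)
    · exact soloInformed_isSemialgebraic_setOf_forall fun t =>
        soloInformed_isSemialgebraic_setOf_forall_prop fun h =>
        soloInformed_isSemialgebraic_setOf_imp (soloInformed_isSemialgebraic_setOf_const _)
          (SoloInformedPTerm.isSemialgebraic_setOf_coin _ _)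
  -- (2) the original parameter satisfies the clauses
  have hadm₀ : P.SoloInformedAdm p₀ := (hgood p₀ hp₀).1
  have hValid₀ : Valid p₀ := by
    refine ⟨hp₀, fun t t' h hk => ?_, fun t h hk => ?_, fun t h hk => ?_⟩
    · obtain ⟨h', hk'⟩ := (SoloInformedPTerm.sigma_mk_eq_iff _ _).1 hk
      refine SoloInformedPTerm.coin_of_rep_eq
        ((SoloInformedPTerm.adm_castDim_iff h _ _).2 (hadm₀ t)) (hadm₀ t') ?_
      rw [SoloInformedPTerm.rep_castDim]
      exact hk'
    · obtain ⟨h', hk'⟩ := (SoloInformedPTerm.sigma_mk_eq_iff _ _).1 hk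
      refine SoloInformedPTerm.coin_of_rep_eq
        ((SoloInformedPTerm.adm_castDim_iff h _ _).2 (hadm₀ t)) (hAadm _) ?_
      rw [SoloInformedPTerm.rep_castDim, SoloInformedPTerm.rep_const r _ hr]
      exact hk'
    · obtain ⟨h', hk'⟩ := (SoloInformedPTerm.sigma_mk_eq_iff _ _).1 hk
      refine SoloInformedPTerm.coin_of_rep_eq
        ((SoloInformedPTerm.adm_castDim_iff h _ _).2 (hadm₀ t)) (hBadm _) ?_
      rw [SoloInformedPTerm.rep_castDim, SoloInformedPTerm.rep_const r' _ hr']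
      exact hk'
  -- (3) an algebraic good parameter with `ℚ`-semialgebraic fibres
  let e := Fintype.equivFin K
  have hVe : IsSemialgebraic ℚ {c : Fin (Fintype.card K) → ℝ | Valid (c ∘ e)} :=
    hValid.preimage_comp e
  have h₀e : Valid ((p₀ ∘ e.symm) ∘ e) := by
    have : (p₀ ∘ e.symm) ∘ e = p₀ := by ext i; simp
    rw [this]
    exact hValid₀
  obtain ⟨c₁, hc₁V, -, hc₁F⟩ := soloInformed_realParameter_transfer_core hVe h₀e
  have hRF : SoloInformedRatFibres (c₁ ∘ e) := soloInformedRatFibres_comp (p' := c₁) hc₁F e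
  obtain ⟨hp₁V, hcl, hclA, hclB⟩ := hc₁V
  have hadm : P.SoloInformedAdm (c₁ ∘ e) := (hgood _ hp₁V).1
  obtain ⟨q, hq, hqrel⟩ := hrat _ hp₁V hRF
  -- (4) the class-function principle in `FormalRep ℚ ⧸ RelationsBdd ℚ`
  let N := soloInformedRelationsBdd ℚ
  let π : KZOver.FormalRep ℚ →+ KZOver.FormalRep ℚ ⧸ N := QuotientAddGroup.mk' N
  have hπ : ∀ x y : KZOver.FormalRep ℚ, π x = π y ↔ x - y ∈ N := fun x y => by
    simp only [π]
    rw [QuotientAddGroup.mk'_apply, QuotientAddGroup.mk'_apply, QuotientAddGroup.eq_iff_sub_mem]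
  have hstep : ∀ (t : P.ι) {m : ℕ} (h : P.dim t = m) (C : SoloInformedPTerm K m)
      (y : KZOver.IntegralRep ℚ m), C.SoloInformedAdm (c₁ ∘ e) →
      C.rep (c₁ ∘ e) = y.baseChange ℝ → ((P.term t).castDim h).SoloInformedCoin C (c₁ ∘ e) →
      π (KZOver.of (q t)) = π (KZOver.of y) := by
    intro t m h C y hC hCy hcoin
    have hTadm : ((P.term t).castDim h).SoloInformedAdm (c₁ ∘ e) :=
      (SoloInformedPTerm.adm_castDim_iff h _ _).2 (hadm t)
    obtain ⟨hd, hi⟩ := SoloInformedPTerm.rep_congr_of_coin hcoin hTadm hC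
    have hrepT : ((P.term t).castDim h).rep (c₁ ∘ e) =
        (SoloInformedPTerm.castRep h (q t)).baseChange ℝ := by
      rw [SoloInformedPTerm.rep_castDim, SoloInformedPTerm.baseChange_castRep, hq t]
    have hbdd : SoloInformedBddRep (SoloInformedPTerm.castRep h (q t)) := by
      rw [← soloInformedBddRep_baseChange_iff (k' := ℝ), ← hrepT]
      exact SoloInformedPTerm.bddRep_rep hTadm
    rw [hrepT, hCy] at hd hi
    have hmem : KZOver.of (SoloInformedPTerm.castRep h (q t)) - KZOver.of y ∈ N :=
      soloInformed_sub_mem_relationsBdd_of_eqOn hbdd hd hi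
    rw [SoloInformedPTerm.of_castRep] at hmem
    exact (hπ _ _).2 hmem
  have hsum := P.sum_eq_of_combo_eq_sub hcombo hAB (fun t => π (KZOver.of (q t)))
    (π (KZOver.of r)) (π (KZOver.of r')) ?_ ?_ ?_
  · have hzero : ∑ t, P.coef t • π (KZOver.of (q t)) = 0 := by
      have : π (∑ t, P.coef t • KZOver.of (q t)) = ∑ t, P.coef t • π (KZOver.of (q t)) := by
        rw [map_sum]
        simp only [map_zsmul]
      rw [← this]
      simp only [π]
      rw [QuotientAddGroup.mk'_apply, QuotientAddGroup.eq_zero_iff]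
      exact hqrel
    rw [hzero, eq_comm, sub_eq_zero] at hsum
    exact (hπ _ _).1 hsum
  · intro t t' hk
    have h : P.dim t = P.dim t' := congrArg Sigma.fst hk
    exact hstep t h (P.term t') (q t') (hadm t') (hq t').symm (hcl t t' h hk)
  · intro t hk
    have h : P.dim t = n := congrArg Sigma.fst hk
    exact hstep t h cA r (hAadm _) (SoloInformedPTerm.rep_const r _ hr) (hclA t h hk)
  · intro t hk
    have h : P.dim t = n' := congrArg Sigma.fst hk
    exact hstep t h cB r' (hBadm _) (SoloInformedPTerm.rep_const r' _ hr') (hclB t h hk)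

/-- **Corollary T1.** Under the same hypothesis, bounded `KZ_ℝ`-equivalence of the base changes
implies `KZ`-equivalence over `ℚ` (full Kontsevich–Zagier relation module).
[cite: KontsevichZagier2001, §1.2, Conjecture 1] -/
theorem soloInformed_equivalent_of_bddEquivalent_real
    (hgen : ∀ c ∈ soloInformedBddGenerators ℝ, SoloInformedDefinableRel c)
    {n n' : ℕ} (r : KZOver.IntegralRep ℚ n) (r' : KZOver.IntegralRep ℚ n')
    (hr : SoloInformedBddRep r) (hr' : SoloInformedBddRep r')
    (h : SoloInformedBddEquivalent (r.baseChange ℝ) (r'.baseChange ℝ)) :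
    SoloInformedBddEquivalent r r' ∧ KZOver.Equivalent r r' :=
  have h' := soloInformed_realParameterTransfer_bdd hgen r r' hr hr' h
  ⟨h', soloInformedRelationsBdd_le_relations ℚ h'⟩

/-- **Corollary T2 (the two theorems are one).** Under the same hypothesis, bounded
`KZ_ℝ`-equivalence of base changes of bounded `ℚ`-representations is EQUIVALENT to bounded
`KZ_ℚ`-equivalence. [cite: KontsevichZagier2001, §1.2] -/
theorem soloInformed_bddEquivalent_baseChange_iff
    (hgen : ∀ c ∈ soloInformedBddGenerators ℝ, SoloInformedDefinableRel c)
    {n n' : ℕ} (r : KZOver.IntegralRep ℚ n) (r' : KZOver.IntegralRep ℚ n')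
    (hr : SoloInformedBddRep r) (hr' : SoloInformedBddRep r') :
    SoloInformedBddEquivalent (r.baseChange ℝ) (r'.baseChange ℝ) ↔ SoloInformedBddEquivalent r r' :=
  ⟨soloInformed_realParameterTransfer_bdd hgen r r' hr hr', fun h => by
    have h' := soloInformed_baseChange_mem_relationsBdd (k' := ℝ) h
    show KZOver.of _ - KZOver.of _ ∈ _
    simpa [KZOver.baseChange_of, map_sub] using h'⟩

end Summit.KontsevichZagierPeriods.KontsevichZagierPeriods.Theorems
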